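import Summits.BirchSwinnertonDyer.BirchSwinnertonDyer.Theses.QuadraticBranchSignedControl
import Summits.BirchSwinnertonDyer.BirchSwinnertonDyer.Theorems.QuadraticBranchSignedControlEtaLayerComparison
import Summits.BirchSwinnertonDyer.BirchSwinnertonDyer.Theorems.QuadraticBranchSignedControlEtaTransportSignedOfLayerComparison
import HarnessLib

/-!
# Route `QuadraticBranchSignedControl` (rung K8, cell `bsd-potss`), crux `EtaTransportSigned`
# (stmt-BirchSwinnertonDyer-19115): the PLUS half (MC⁺_η) UNCONDITIONALLY, and the crux from Kobayashi's
# Thm. 7.4 at `η` ALONE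

WHAT. With `EtaLayerComparison` proved (`etaLayerComparison_proof`, p440809) every frame of seat
k8q-c3 g0's chain is discharged: `hLayer ⟹ hMap ⟹ hSel ⟹ hA ⟹ hdec`, so
* `etaTransportPlus` — the PLUS conjunct of the crux (the `η`-component form of Kobayashi's even main
  conjecture for the twist `V`: for every `η`-signed dual datum `D` of `Sel⁺(V/K₀ℚ_∞)^η`,
  `X` is `Λ`-finitely-generated torsion with `Char X = (L_p⁺(V,η))` — GIVEN the `F`-form (C1_η)
  `QuadraticBranchPlusMainConjectureAt V p`, an open conjecture sitting in HYPOTHESIS position inside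
  the statement) is now an UNCONDITIONAL theorem (`etaTransportPlus_of_decomposition`, p418003, fed
  with the produced decomposition);
* `etaTransportSigned_of_thm74` — the whole crux `EtaTransportSigned` follows from the held published
  input `PublishedInputThm74` = `Kobayashi2003.thm74_etaEvenMC_iff_etaOddMC` (Kobayashi 2003
  Thm. 7.4 (ii) ⟺ (iii) at `η`) ALONE (glue 19585 ∘ item 19583).

HONEST FRAMING (cell `bsd-potss`, run/shared/lean/pub/bsd-potss/; FULL-BSD rank ≤ 1 programme):
`etaTransportPlus` is unconditional but carries (C1_η) as an antecedent INSIDE its statement (as the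
crux does); `etaTransportSigned_of_thm74` is a CONDITIONAL RESULT on the named Literature fact
(Kobayashi's Thm. 7.4, deep: Coleman maps + Kato's Euler system; not proved in the tree). The crux
item 19115 therefore remains open exactly at its declared published input 19584; nothing about
(C1_η) or `BSD(W, p)` is claimed; BSD is not proved by any of this. No definition, no named fact
introduced, no `sorry`, axioms standard. Seat `bsd-potss-k8q-c3` (prover), g2.

References: [Kobayashi2003] Def. 1.1 (p. 2), Def. 2.1 (p. 5), §4 p. 8, Thm. 7.4 (p. 13);
[GreenbergLNM1716] §3.
-/

set_option autoImplicit false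
set_option linter.dupNamespace false

noncomputable section

open scoped Classical MatrixGroups ModularForm

open CongruenceSubgroup Field WeierstrassCurve
open NumberField IsDedekindDomain
open Literature.NumberTheory.EllipticCurves
open Literature.NumberTheory.EllipticCurves.ModularForms
open Literature.NumberTheory.GaloisRepresentations
open Summit.BirchSwinnertonDyer.Rank1Residual.Additive

namespace Summit.BirchSwinnertonDyer.BirchSwinnertonDyer.Theorems

/-- **The decomposition frame `hdec` (ctrl's piece (i)) — now a THEOREM**: for every admissible
`(p, K₀, η, V, κ, γ)` there is a quadratic model `F = ℚ(√p*) ⊂ K₀`, `V' = V_F`, and a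
`Γ`-equivariant additive isomorphism `Sel⁺(V'/F_∞) ≃ Sel⁺(V/ℚ_∞) × Sel⁺(V/K₀ℚ_∞)^η`
(`etaDecomposition_of_frames` fed with `frameA_of_selmerComparison ∘ selmerComparison_of_map_eq ∘
selmerMap_of_layerMaps ∘ etaLayerComparison_proof` and the model change (i-f)).
[cite: Kobayashi2003, §4 p. 8, Def. 1.1 (p. 2), Def. 2.1 (p. 5)] [cite: GreenbergLNM1716, §3] -/
theorem etaDecomposition :
    ∀ (p : ℕ) [Fact p.Prime], 5 ≤ p →
      ∀ (K₀ : Type) [Field K₀] [NumberField K₀] [IsCyclotomicExtension {p} ℚ K₀]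
        [(galRange (K := ℚ) K₀).Normal] (ηq : absoluteGaloisGroup ℚ →* ℤˣ),
        (∀ σ ∈ galRange (K := ℚ) K₀, ηq σ = 1) → ηq ≠ 1 →
      ∀ (V : WeierstrassCurve ℚ) [V.IsElliptic] [V.IsGloballyMinimal],
        V.HasGoodReductionAtPrime p → V.frobeniusTrace p = 0 →
      ∀ (κ : ZpExtension ℚ p) (γ : absoluteGaloisGroup ℚ),
        κ.IsCyclotomic → κ.IsTopGenerator γ → γ ∈ galRange (K := ℚ) K₀ →
        IsCyclotomicVariable p γ →
      ∃ (F : Type) (_ : Field F) (_ : NumberField F) (V' : WeierstrassCurve F) (_ : V'.IsElliptic)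
        (κF : ZpExtension F p) (γF : absoluteGaloisGroup F)
        (Φ : Kobayashi2003.signedSelmerInfty V' κF 1 ≃+
          Kobayashi2003.signedSelmerInfty V κ 1 × towerSignedSelmerInftyEta V κ K₀ ℚ_[p] ηq 1),
        Module.finrank ℚ F = 2 ∧ (∃ θ : F, θ ^ 2 = algebraMap ℚ F ((-1) ^ (p / 2) * p)) ∧
        (∃ C : VariableChange F, C • V.baseChange F = V') ∧
        κF.IsCyclotomic ∧ κF.IsTopGenerator γF ∧
        (∃ ζ : ℤ_[p]ˣ, IsOfFinOrder ζ ∧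
          ((GaloisRep.cyclotomicCharacter F p γF * ζ : ℤ_[p]ˣ) : ℤ_[p]) =
            (cyclotomicGenerator p : ℤ_[p])) ∧
        ∀ s : Kobayashi2003.signedSelmerInfty V' κF 1,
          ((Φ ⟨V'.conjH1 p κF.kerSubgroup γF s,
              Kobayashi2003.conjH1_mem_signedSelmerInfty V' κF 1 γF s.2⟩).1 : V.subgroupH1 p κ.kerSubgroup) =
            V.conjH1 p κ.kerSubgroup γ (Φ s).1 ∧
          ((Φ ⟨V'.conjH1 p κF.kerSubgroup γF s,
              Kobayashi2003.conjH1_mem_signedSelmerInfty V' κF 1 γF s.2⟩).2 :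
              V.subgroupH1 p (towerTopSubgroup κ K₀)) =
            V.conjH1 p (towerTopSubgroup κ K₀) γ (Φ s).2 := by
  -- frame (i-f): the plus Selmer group does not depend on the model of the completion at `p`
  have hIF : ∀ (p : ℕ) [Fact p.Prime] (V : WeierstrassCurve ℚ) (κ : ZpExtension ℚ p),
      Kobayashi2003.signedSelmerInfty V κ 1 = strictSignedSelmerInfty V κ ℚ_[p] 1 := by
    intro p _ V κ
    have hpP : p.Prime := Fact.out
    obtain ⟨v₀, hv₀⟩ : ∃ v : HeightOneSpectrum (𝓞 ℚ), ((p : ℕ) : 𝓞 ℚ) ∈ v.asIdeal := by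
      have hnu : ¬ IsUnit ((p : ℕ) : 𝓞 ℚ) := by
        intro h
        have h' := h.map Rat.ringOfIntegersEquiv
        rw [map_natCast, Int.isUnit_iff_natAbs_eq, Int.natAbs_natCast] at h'
        exact hpP.one_lt.ne' h'
      obtain ⟨M, hM, hle⟩ := Ideal.exists_le_maximal (Ideal.span {((p : ℕ) : 𝓞 ℚ)})
        (by rwa [Ne, Ideal.span_singleton_eq_top])
      have hpM : ((p : ℕ) : 𝓞 ℚ) ∈ M := hle (Ideal.mem_span_singleton_self _)
      refine ⟨⟨M, hM.isPrime, fun hbot => ?_⟩, hpM⟩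
      rw [hbot, Ideal.mem_bot] at hpM
      exact hpP.ne_zero (by exact_mod_cast hpM)
    rw [signedSelmerInfty_one_eq_strictSignedSelmerInfty_adicCompletion V κ v₀ hv₀,
      strictSignedSelmerInfty_one_adicCompletion_eq_padic V κ v₀ hv₀]
  exact etaDecomposition_of_frames (frameA_of_selmerComparison
    (selmerComparison_of_map_eq (selmerMap_of_layerMaps etaLayerComparison_proof)))
    fun p _ _ V _ _ _ _ κ _ => hIF p V κ

/-- **(MC⁺_η), the PLUS half of the crux `EtaTransportSigned` — UNCONDITIONAL** (given, inside the
statement, the `F`-form (C1_η) `QuadraticBranchPlusMainConjectureAt V p`): for every `η`-signed dual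
datum `D` of `Sel⁺(V/K₀ℚ_∞)^η`, `X(D)` is `Λ`-finitely-generated torsion with `Char X(D) = (L_p⁺(V,η))`.
`etaTransportPlus_of_decomposition` (p418003) fed with the produced decomposition `etaDecomposition`.
[cite: Kobayashi2003, §4 p. 8 (the η-component of X⁺ has characteristic ideal (L_p⁺(E,η,X)))] -/
theorem etaTransportPlus :
    ∀ (p : ℕ) [Fact p.Prime], 5 ≤ p →
    ∀ (K₀ : Type) [Field K₀] [NumberField K₀] [IsCyclotomicExtension {p} ℚ K₀]
      [(galRange (K := ℚ) K₀).Normal] (ηq : absoluteGaloisGroup ℚ →* ℤˣ),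
      (∀ σ ∈ galRange (K := ℚ) K₀, ηq σ = 1) → ηq ≠ 1 →
    ∀ (V : WeierstrassCurve ℚ) [V.IsElliptic] [V.IsGloballyMinimal] {N : ℕ} [NeZero N]
      {f : CuspForm (Gamma0 N) 2},
      p ≠ 2 → V.HasGoodReductionAtPrime p → V.frobeniusTrace p = 0 →
      QuadraticBranchPlusMainConjectureAt V p → IsNewformOf V f →
    ∀ (ϖ : ℚ), (if Even (p / 2) then (ϖ : ℝ) * V.realPeriodRat = plusPeriod f
        else (ϖ : ℝ) * V.imaginaryPeriodRat = minusPeriod f) →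
    ∀ (Lη : IwasawaAlgebra p), IsQuadraticBranchPlusLFunction f p ϖ Lη →
    ∀ (κ : ZpExtension ℚ p) (γ : absoluteGaloisGroup ℚ),
      κ.IsCyclotomic → κ.IsTopGenerator γ → γ ∈ galRange (K := ℚ) K₀ →
      IsCyclotomicVariable p γ →
    ∀ (D : EtaSignedSelmerDualData V κ K₀ ℚ_[p] ηq γ 1),
      Module.Finite (IwasawaAlgebra p) D.X ∧ Module.IsTorsion (IwasawaAlgebra p) D.X ∧
        D.charIdeal = Ideal.span {Lη} :=
  etaTransportPlus_of_decomposition etaDecomposition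

/-- **The crux `EtaTransportSigned` from Kobayashi's Thm. 7.4 at `η` ALONE** (CONDITIONAL RESULT on
the named Literature fact `Kobayashi2003.thm74_etaEvenMC_iff_etaOddMC` = item 19584
`PublishedInputThm74`, held cite-level): glue 19585 applied to the proved item 19583.
[cite: Kobayashi2003, Thm. 7.4 (p. 13), §4 p. 8] -/
theorem etaTransportSigned_of_thm74 (h74 : Kobayashi2003.thm74_etaEvenMC_iff_etaOddMC) :
    Summit.BirchSwinnertonDyer.BirchSwinnertonDyer.Theses.QuadraticBranchSignedControl.EtaTransportSigned :=
  etaTransportSignedOfLayerComparison_proof etaLayerComparison_proof h74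

end Summit.BirchSwinnertonDyer.BirchSwinnertonDyer.Theorems

end
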